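import Summits.RiemannHypothesis.RiemannHypothesis.Theorems.Splittings.ScrewKreinCoreTranslates
import HarnessLib

/-!
# Screw index transfer via Kreĭn definitizability — analytic core, part 3/5: (D) the symbol of the correlation

CUT 3/5 of `ScrewIndexTransferKreinCore` (rh-split-screw-bridge g5).  `pieceD_holds : PieceD`: the two-sided
Laplace transform of `c_φ(u) = ∫ (Qφ)(x) conj((Qφ)(x+u)) dx` is entire and equals
`Q(iw) · conj Q(conj(iw)) · φ̂(−w) · conj(φ̂(w̄))` — `differentiable_bilap` (holomorphic parametric integral),
`bilap_deriv` / `bilap_iteratedDeriv` / `bilap_applyQ` (integration by parts), `conj_bilap`, `bilap_corr_gen`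
(Fubini + translation).

HONEST LABEL.  `CofiniteCriticalLine` (all but finitely many nontrivial zeros on the line) is NOT RH, and
ETAIL (eventual positivity of the screw pivots) is NOT the screw criterion `∀ M, 0 < screwPivot M`; this module is
part of a chain relating the two tails to each other and decides neither.  Nothing here bears on the truth of RH.
-/

noncomputable section

set_option linter.dupNamespace false

namespace Summit.RiemannHypothesis.RiemannHypothesis.Theorems.Splittings.ScrewKreinCore

open Finset Complex MeasureTheory Set Filter Topology
open Literature.NumberTheory.LFunctions
open Literature.Analysis.OperatorTheory
open Summit.RiemannHypothesis.RiemannHypothesis.Theses.RuelleBand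
open Summit.RiemannHypothesis.RiemannHypothesis.Theorems.IntegerScrew

/-! ## Towards (D): two-sided Laplace transforms of test functions -/

/-- For continuous compactly supported `g`, `u ↦ g u · e^{−w u}` is integrable (the two-sided Laplace integrand). -/
theorem integrable_bilap_integrand {g : ℝ → ℂ} (hg : Continuous g) (hgs : HasCompactSupport g)
    (w : ℂ) : Integrable fun u : ℝ => g u * cexp (-(w * u)) :=
  (hg.mul (by fun_prop)).integrable_of_hasCompactSupport
    (HasCompactSupport.intro hgs fun u hu => by simp [image_eq_zero_of_notMem_tsupport hu])

/-- The two-sided Laplace transform of a continuous compactly supported function is entire. -/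
theorem differentiable_bilap {g : ℝ → ℂ} (hg : Continuous g) (hgs : HasCompactSupport g) :
    Differentiable ℂ (bilap g) := by
  intro w₀
  have hF_meas : ∀ᶠ w in 𝓝 w₀,
      AEStronglyMeasurable (fun u : ℝ => g u * cexp (-(w * u))) volume :=
    Eventually.of_forall fun w => (integrable_bilap_integrand hg hgs w).aestronglyMeasurable
  have hF_int : Integrable (fun u : ℝ => g u * cexp (-(w₀ * u))) volume :=
    integrable_bilap_integrand hg hgs w₀
  have hF'_cont : ∀ w : ℂ, Continuous fun u : ℝ => g u * (cexp (-(w * u)) * -(1 * (u : ℂ))) :=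
    fun w => hg.mul (by fun_prop)
  have hF'_meas : AEStronglyMeasurable
      (fun u : ℝ => g u * (cexp (-(w₀ * u)) * -(1 * (u : ℂ)))) volume :=
    (hF'_cont w₀).aestronglyMeasurable
  have h_bound : ∀ᵐ u : ℝ ∂volume, ∀ w ∈ Metric.ball w₀ 1,
      ‖g u * (cexp (-(w * u)) * -(1 * (u : ℂ)))‖ ≤
        ‖g u‖ * (Real.exp ((‖w₀‖ + 1) * |u|) * |u|) := by
    refine Eventually.of_forall fun u w hw => ?_
    rw [norm_mul, norm_mul, norm_neg, one_mul, Complex.norm_real, Real.norm_eq_abs,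
      Complex.norm_exp]
    refine mul_le_mul_of_nonneg_left (mul_le_mul_of_nonneg_right ?_ (abs_nonneg u))
      (norm_nonneg _)
    rw [Real.exp_le_exp]
    have hw' : ‖w‖ ≤ ‖w₀‖ + 1 := by
      have h := Metric.mem_ball.mp hw
      rw [dist_eq_norm] at h
      calc ‖w‖ = ‖(w - w₀) + w₀‖ := by rw [sub_add_cancel]
        _ ≤ ‖w - w₀‖ + ‖w₀‖ := norm_add_le _ _
        _ ≤ ‖w₀‖ + 1 := by linarith
    calc (-(w * (u : ℂ))).re ≤ ‖-(w * (u : ℂ))‖ := Complex.re_le_norm _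
      _ = ‖w‖ * |u| := by rw [norm_neg, norm_mul, Complex.norm_real, Real.norm_eq_abs]
      _ ≤ (‖w₀‖ + 1) * |u| := mul_le_mul_of_nonneg_right hw' (abs_nonneg u)
  have bound_integrable : Integrable (fun u : ℝ => ‖g u‖ * (Real.exp ((‖w₀‖ + 1) * |u|) * |u|))
      volume := by
    refine Continuous.integrable_of_hasCompactSupport ?_ ?_
    · exact (continuous_norm.comp hg).mul
        ((Real.continuous_exp.comp (continuous_const.mul continuous_abs)).mul continuous_abs)
    · exact HasCompactSupport.intro hgs fun u hu => by simp [image_eq_zero_of_notMem_tsupport hu]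
  have h_diff : ∀ᵐ u : ℝ ∂volume, ∀ w ∈ Metric.ball w₀ 1,
      HasDerivAt (fun w : ℂ => g u * cexp (-(w * u))) (g u * (cexp (-(w * u)) * -(1 * (u : ℂ)))) w :=
    Eventually.of_forall fun u w _ => (((hasDerivAt_id w).mul_const (u : ℂ)).neg.cexp).const_mul (g u)
  exact (hasDerivAt_integral_of_dominated_loc_of_deriv_le (Metric.ball_mem_nhds w₀ zero_lt_one)
    hF_meas hF_int hF'_meas h_bound bound_integrable h_diff).2.differentiableAt

/-- The derivative of a test function is a test function. -/
theorem isTest_deriv {ψ : ℝ → ℂ} (hψ : IsTest ψ) : IsTest (deriv ψ) :=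
  ⟨by simpa using hψ.1.iterate_deriv 1, hψ.2.deriv⟩

/-- Every iterated derivative of a test function is a test function. -/
theorem isTest_iteratedDeriv {ψ : ℝ → ℂ} (hψ : IsTest ψ) : ∀ j : ℕ, IsTest (iteratedDeriv j ψ)
  | 0 => by simpa [iteratedDeriv_zero] using hψ
  | j + 1 => by rw [iteratedDeriv_succ]; exact isTest_deriv (isTest_iteratedDeriv hψ j)

/-- Integration by parts: `bilap ψ' v = v · bilap ψ v` for a test function `ψ`. -/
theorem bilap_deriv {ψ : ℝ → ℂ} (hψ : IsTest ψ) (v : ℂ) : bilap (deriv ψ) v = v * bilap ψ v := by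
  have hd : IsTest (deriv ψ) := isTest_deriv hψ
  have hψc : Continuous ψ := hψ.1.continuous
  have hdc : Continuous (deriv ψ) := hd.1.continuous
  have hec : Continuous fun x : ℝ => cexp (-(v * x)) := by fun_prop
  have hu : ∀ x : ℝ, HasDerivAt (fun x : ℝ => cexp (-(v * x))) (cexp (-(v * x)) * -(v * 1)) x := by
    intro x
    have h : HasDerivAt (fun z : ℂ => cexp (-(v * z))) (cexp (-(v * (x : ℂ))) * -(v * 1)) (x : ℂ) :=
      (((hasDerivAt_id (x : ℂ)).const_mul v).neg).cexp
    exact h.comp_ofReal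
  have key := integral_mul_deriv_eq_deriv_mul_of_integrable (u := fun x : ℝ => cexp (-(v * x)))
    (u' := fun x : ℝ => cexp (-(v * x)) * -(v * 1)) (v := ψ) (v' := deriv ψ)
    (fun x _ => hu x) (fun x _ => ((hψ.1.differentiable (by simp)) x).hasDerivAt)
    ((hec.mul hdc).integrable_of_hasCompactSupport
      (HasCompactSupport.intro hd.2 fun x hx => by simp [image_eq_zero_of_notMem_tsupport hx]))
    (((hec.mul continuous_const).mul hψc).integrable_of_hasCompactSupport
      (HasCompactSupport.intro hψ.2 fun x hx => by simp [image_eq_zero_of_notMem_tsupport hx]))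
    ((hec.mul hψc).integrable_of_hasCompactSupport
      (HasCompactSupport.intro hψ.2 fun x hx => by simp [image_eq_zero_of_notMem_tsupport hx]))
  unfold bilap
  rw [show (fun u : ℝ => deriv ψ u * cexp (-(v * u))) = fun u : ℝ => cexp (-(v * (u : ℂ))) * deriv ψ u
    from funext fun u => mul_comm _ _, key, ← integral_neg, ← integral_const_mul]
  congr 1; funext x; ring

/-- Two-sided Laplace transform of the `j`-th derivative of a test function: `bilap (ψ⁽ʲ⁾) v = v ^ j · bilap ψ v`. -/
theorem bilap_iteratedDeriv {ψ : ℝ → ℂ} (hψ : IsTest ψ) (v : ℂ) :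
    ∀ j : ℕ, bilap (iteratedDeriv j ψ) v = v ^ j * bilap ψ v
  | 0 => by simp [iteratedDeriv_zero]
  | j + 1 => by
    rw [iteratedDeriv_succ, bilap_deriv (isTest_iteratedDeriv hψ j), bilap_iteratedDeriv hψ v j]
    ring

/-- `bilap (Q(−i d/dx) φ) v = Q(−i v) · bilap φ v`. -/
theorem bilap_applyQ (Q : Polynomial ℂ) {φ : ℝ → ℂ} (hφ : IsTest φ) (v : ℂ) :
    bilap (applyQ Q φ) v = Q.eval (-I * v) * bilap φ v := by
  have hint : ∀ j ∈ range (Q.natDegree + 1), Integrable fun u : ℝ =>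
      Q.coeff j * (-I) ^ j * (iteratedDeriv j φ u * cexp (-(v * u))) :=
    fun j _ => (integrable_bilap_integrand (isTest_iteratedDeriv hφ j).1.continuous
      (isTest_iteratedDeriv hφ j).2 v).const_mul _
  have hj : ∀ j : ℕ, (∫ u : ℝ, iteratedDeriv j φ u * cexp (-(v * u))) = v ^ j * bilap φ v :=
    fun j => bilap_iteratedDeriv hφ v j
  show (∫ u : ℝ, applyQ Q φ u * cexp (-(v * u))) = Q.eval (-I * v) * bilap φ v
  calc (∫ u : ℝ, applyQ Q φ u * cexp (-(v * u)))
      = ∫ u : ℝ, ∑ j ∈ range (Q.natDegree + 1),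
          Q.coeff j * (-I) ^ j * (iteratedDeriv j φ u * cexp (-(v * u))) := by
        congr 1; funext u; rw [applyQ, Finset.sum_mul]
        exact sum_congr rfl fun j _ => by ring
    _ = ∑ j ∈ range (Q.natDegree + 1),
          Q.coeff j * (-I) ^ j * ∫ u : ℝ, iteratedDeriv j φ u * cexp (-(v * u)) := by
        rw [integral_finsetSum _ hint]
        exact sum_congr rfl fun j _ => integral_const_mul _ _
    _ = Q.eval (-I * v) * bilap φ v := by
        rw [Polynomial.eval_eq_sum_range, Finset.sum_mul]
        exact sum_congr rfl fun j _ => by rw [hj j]; ring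

/-- Complex conjugation commutes with the two-sided Laplace transform: `conj (bilap g (conj w)) = bilap (conj ∘ g) w`. -/
theorem conj_bilap (g : ℝ → ℂ) (w : ℂ) :
    (starRingEnd ℂ) (bilap g ((starRingEnd ℂ) w)) = bilap (fun u => (starRingEnd ℂ) (g u)) w := by
  unfold bilap
  rw [← integral_conj]
  congr 1; funext u
  rw [map_mul, ← Complex.exp_conj, map_neg, map_mul, Complex.conj_conj, Complex.conj_ofReal]

/-- `conj (Q(z)) = Q^σ(conj z)` with `Q^σ` the coefficient-conjugated polynomial. -/
theorem conj_eval (Q : Polynomial ℂ) (z : ℂ) :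
    (starRingEnd ℂ) (Q.eval z) = (Q.map (starRingEnd ℂ)).eval ((starRingEnd ℂ) z) := by
  rw [Polynomial.eval_map, Polynomial.eval₂_at_apply]

/-- Fubini + translation: `bilap (A ⋆ A^*) w = bilap A (−w) · conj (bilap A (w̄))`. -/
theorem bilap_corr_gen {A : ℝ → ℂ} (hA : Continuous A) (hAs : HasCompactSupport A) (w : ℂ) :
    bilap (fun u => ∫ x, A x * (starRingEnd ℂ) (A (x + u))) w =
      bilap A (-w) * (starRingEnd ℂ) (bilap A ((starRingEnd ℂ) w)) := by
  rw [conj_bilap]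
  obtain ⟨R, hR⟩ := hAs.isCompact.isBounded.subset_closedBall 0
  have hA0 : ∀ x, R < |x| → A x = 0 := fun x hx => image_eq_zero_of_notMem_tsupport fun h => by
    have := hR h; rw [Metric.mem_closedBall, dist_zero_right, Real.norm_eq_abs] at this; linarith
  have hprod : Integrable (Function.uncurry fun u x : ℝ =>
      A x * (starRingEnd ℂ) (A (x + u)) * cexp (-(w * u))) (volume.prod volume) := by
    refine Continuous.integrable_of_hasCompactSupport ?_ ?_
    · exact ((hA.comp continuous_snd).mul
        (Complex.continuous_conj.comp (hA.comp (continuous_snd.add continuous_fst)))).mul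
        (by fun_prop)
    · refine HasCompactSupport.intro
        ((isCompact_closedBall (0 : ℝ) (2 * R)).prod (isCompact_closedBall (0 : ℝ) R)) fun p hp => ?_
      rw [Set.mem_prod, not_and_or] at hp
      simp only [Metric.mem_closedBall, dist_zero_right, Real.norm_eq_abs, not_le] at hp
      rcases hp with h | h
      · by_cases hx : R < |p.2|
        · simp [Function.uncurry, hA0 _ hx]
        · have h2 : R < |p.2 + p.1| := by
            have : |p.1| ≤ |p.2 + p.1| + |p.2| := by
              calc |p.1| = |p.2 + p.1 - p.2| := by rw [add_sub_cancel_left]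
                _ ≤ |p.2 + p.1| + |p.2| := abs_sub _ _
            linarith [not_lt.mp hx]
          simp [Function.uncurry, hA0 _ h2]
      · simp [Function.uncurry, hA0 _ h]
  unfold bilap
  calc (∫ u : ℝ, (∫ x, A x * (starRingEnd ℂ) (A (x + u))) * cexp (-(w * u)))
      = ∫ u : ℝ, ∫ x, A x * (starRingEnd ℂ) (A (x + u)) * cexp (-(w * u)) := by
        congr 1; funext u; rw [← integral_mul_const]
    _ = ∫ x : ℝ, ∫ u, A x * (starRingEnd ℂ) (A (x + u)) * cexp (-(w * u)) :=
        integral_integral_swap hprod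
    _ = ∫ x : ℝ, A x * cexp (-(-w * x)) * ∫ y, (starRingEnd ℂ) (A y) * cexp (-(w * y)) := by
        congr 1; funext x
        have h1 : (∫ u, A x * (starRingEnd ℂ) (A (x + u)) * cexp (-(w * u))) =
            A x * ∫ u, (fun y : ℝ => (starRingEnd ℂ) (A y) * cexp (-(w * (y - x)))) (x + u) := by
          rw [← integral_const_mul]
          congr 1; funext u; simp only [ofReal_add, add_sub_cancel_left]; ring
        have h2 : (∫ y : ℝ, (starRingEnd ℂ) (A y) * cexp (-(w * (y - x)))) =
            cexp (-(-w * x)) * ∫ y : ℝ, (starRingEnd ℂ) (A y) * cexp (-(w * y)) := by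
          rw [← integral_const_mul]
          congr 1; funext y
          rw [show -(w * ((y : ℂ) - x)) = -(-w * x) + -(w * y) by ring, Complex.exp_add]; ring
        rw [h1, integral_add_left_eq_self
          (fun y : ℝ => (starRingEnd ℂ) (A y) * cexp (-(w * (y - x)))) x, h2]
        ring
    _ = (∫ x : ℝ, A x * cexp (-(-w * x))) * ∫ y, (starRingEnd ℂ) (A y) * cexp (-(w * y)) :=
        integral_mul_const _ _

/-- **(D) holds.** -/
theorem pieceD_holds : PieceD := by
  intro Q φ hφ
  have hA : Continuous (applyQ Q φ) := continuous_applyQ Q hφ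
  have hAs : HasCompactSupport (applyQ Q φ) := hasCompactSupport_applyQ Q hφ
  have hφc : Continuous φ := hφ.1.continuous
  have hformula : ∀ w : ℂ, bilap (corr Q φ) w =
      Q.eval (I * w) * (starRingEnd ℂ) (Q.eval ((starRingEnd ℂ) (I * w))) *
        bilap φ (-w) * (starRingEnd ℂ) (bilap φ ((starRingEnd ℂ) w)) := by
    intro w
    have h1 : bilap (corr Q φ) w =
        bilap (applyQ Q φ) (-w) * (starRingEnd ℂ) (bilap (applyQ Q φ) ((starRingEnd ℂ) w)) :=
      bilap_corr_gen hA hAs w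
    rw [h1, bilap_applyQ Q hφ, bilap_applyQ Q hφ, map_mul, neg_mul_neg,
      show -I * (starRingEnd ℂ) w = (starRingEnd ℂ) (I * w) by
        rw [map_mul, Complex.conj_I, neg_mul]]
    ring
  refine ⟨?_, hformula⟩
  have hfun : bilap (corr Q φ) = fun w => Q.eval (I * w) * (Q.map (starRingEnd ℂ)).eval (I * w) *
      bilap φ (-w) * bilap (fun u => (starRingEnd ℂ) (φ u)) w := by
    funext w; rw [hformula, conj_eval, Complex.conj_conj, conj_bilap]
  rw [hfun]
  refine (((?_ : Differentiable ℂ fun w => Q.eval (I * w)).mul ?_).mul ?_).mul ?_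
  · exact (Polynomial.differentiable _).comp (differentiable_id.const_mul I)
  · exact (Polynomial.differentiable _).comp (differentiable_id.const_mul I)
  · exact (differentiable_bilap hφc hφ.2).comp differentiable_neg
  · exact differentiable_bilap (Complex.continuous_conj.comp hφc)
      (hφ.2.comp_left (g := starRingEnd ℂ) (map_zero _))

end Summit.RiemannHypothesis.RiemannHypothesis.Theorems.Splittings.ScrewKreinCore

end
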